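import Mathlib
import Summits.Ventures.HodgeRepro2.T5FiniteOrderExtension
import Summits.Ventures.HodgeRepro2.T5SubgroupDescent
import Summits.Ventures.HodgeRepro2.T5ContinuousCharacterExtension
import Summits.Ventures.HodgeRepro2.T5RamifiedCharacterInflation

/-!
# T5PontryaginStep — the Pontryagin step of §F.2 assembled end to end (Tier-5 §G/N4.2 support)

Kernel witness behind the sentence of route/T5-route-3.md §F.2 (l. 83, on the record):
«The character ψ_T ⊗ 1 of H_𝔪 descends to the open subgroup E¹H_𝔪/E¹ of the COMPACT abelian
group E¹(𝔸)/E¹ iff it is trivial on Γ_𝔪 := E¹ ∩ H_𝔪 … the resulting character of the open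
subgroup E¹H_𝔪/E¹ then extends to a (continuous, finite-order) character of E¹(𝔸)/E¹ by
Pontryagin duality, with components ψ_v at v ∈ T and unramified outside T ∪ supp(𝔪).»

Abstract form (G = E¹(𝔸), Δ = E¹, H = H_𝔪, ψ = ψ_T ⊗ 1, Q = ℂˣ): for a commutative topological
group `G`, a subgroup `Δ` (the discrete rational points; only its algebra is used), an OPEN
subgroup `H` and a continuous character `ψ : H →* Q` trivial on `Δ ⊓ H` (the descent criterion of
`T5SubgroupDescent.exists_descend_iff`), there is a continuous character `Ψ` of `G ⧸ Δ` with
`Ψ (h : G) = ψ h` for every `h ∈ H`; if `G ⧸ Δ` is compact and `ψ` has finite order `n`, then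
`Ψ ^ ([G : Δ ⊔ H] · n) = 1` — in particular `Ψ` has finite order; and `Ψ` is trivial on the image of
any subgroup `U ≤ H` on which `ψ` is trivial («unramified outside T ∪ supp(𝔪)»).

Inputs (all accepted in this lane): the algebraic extension trivial on `Δ` is p4's
`T5RamifiedCharacterInflation.exists_extension_of_eq_one_on_inf` (Baer's criterion, `Q` ℤ-rootable —
`ℂˣ` and the circle are instances of p4's `T5ContinuousCharacterExtension`); continuity of a
character agreeing with a continuous one on an open subgroup is p4's
`continuous_of_continuousOn_open_subgroup`; the finite-order bound is this seat's
`T5FiniteOrderExtension.pow_eq_one_of_finiteIndex` and the open-subgroup-of-a-compact-group index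
bound `finiteIndex_of_isOpen`; the openness of the image of `H ⊔ Δ` in `G ⧸ Δ` is this seat's
`T5SubgroupDescent.isOpen_image_sup_of_isOpen`.  What stays prose: that `E¹(𝔸)/E¹` IS compact
(Fujisaki / finiteness of the class number + Dirichlet), Chevalley's theorem on units (the existence
of the modulus `𝔪` with `Γ_𝔪 ⊆ ker ψ_T`), and the adelic objects themselves.
-/

namespace Summit.Ventures.HodgeRepro2.T5PontryaginStep

open Summit.Ventures.HodgeRepro2

variable {G : Type*} [CommGroup G] [TopologicalSpace G] [IsTopologicalGroup G]
variable {Q : Type*} [CommGroup Q] [TopologicalSpace Q] [ContinuousMul Q]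

section extension

variable [RootableBy Q ℤ]

/-- **Extension trivial on `Δ`.** A continuous character `ψ` of an open subgroup `H` of a commutative
topological group `G`, trivial on `Δ ⊓ H`, extends to a continuous character `ψ'` of `G` trivial on
`Δ` (algebraic part: p4's Baer extension from `H ⊔ Δ`; continuity: `ψ'` agrees with `ψ` on the open
subgroup `H`). -/
theorem exists_continuous_extension_eq_one_on (Δ H : Subgroup G) (hH : IsOpen (H : Set G))
    (ψ : H →* Q) (hψ : Continuous ψ) (hΔ : ∀ x : H, (x : G) ∈ Δ → ψ x = 1) :
    ∃ ψ' : G →* Q, Continuous ψ' ∧ (∀ h : H, ψ' h = ψ h) ∧ ∀ d ∈ Δ, ψ' d = 1 := by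
  obtain ⟨ψ', h1, h2⟩ :=
    T5RamifiedCharacterInflation.exists_extension_of_eq_one_on_inf H Δ ψ hΔ
  refine ⟨ψ', ?_, h1, h2⟩
  apply T5ContinuousCharacterExtension.continuous_of_continuousOn_open_subgroup H hH ψ'
  have hcont : Continuous fun x : (H : Set G) => ψ' x := by
    have hfun : (fun x : (H : Set G) => ψ' x) = fun x => ψ ⟨x.1, x.2⟩ :=
      funext fun x => h1 ⟨x.1, x.2⟩
    rw [hfun]
    exact hψ.comp (continuous_subtype_val.subtype_mk _)
  exact continuousOn_iff_continuous_restrict.mpr hcont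

/-- **The descended character of `G ⧸ Δ`.** Under the same hypotheses there is a continuous
character `Ψ` of the quotient `G ⧸ Δ` with `Ψ (h : G) = ψ h` for all `h ∈ H` — the character of
`E¹(𝔸)/E¹` extending `ψ_T ⊗ 1` viewed on `E¹H_𝔪/E¹`. -/
theorem exists_continuous_quotient_character (Δ H : Subgroup G) (hH : IsOpen (H : Set G))
    (ψ : H →* Q) (hψ : Continuous ψ) (hΔ : ∀ x : H, (x : G) ∈ Δ → ψ x = 1) :
    ∃ Ψ : G ⧸ Δ →* Q, Continuous Ψ ∧ ∀ h : H, Ψ (h : G) = ψ h := by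
  obtain ⟨ψ', hc, h1, h2⟩ := exists_continuous_extension_eq_one_on Δ H hH ψ hψ hΔ
  have hker : Δ ≤ ψ'.ker := fun d hd => by
    rw [MonoidHom.mem_ker]
    exact h2 d hd
  refine ⟨QuotientGroup.lift Δ ψ' hker, ?_, fun h => by rw [QuotientGroup.lift_mk, h1 h]⟩
  refine (QuotientGroup.isQuotientMap_mk Δ).continuous_iff.mpr ?_
  have hcomp : (⇑(QuotientGroup.lift Δ ψ' hker) ∘ QuotientGroup.mk) = ⇑ψ' :=
    funext fun g => QuotientGroup.lift_mk Δ hker g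
  rw [hcomp]
  exact hc

end extension

section finiteOrder

omit [TopologicalSpace G] [IsTopologicalGroup G] [TopologicalSpace Q] [ContinuousMul Q] in
/-- A character of `G` trivial on `Δ` and agreeing on `H` with a character of exponent `n` has
exponent `[G : Δ ⊔ H] · n` whenever `Δ ⊔ H` has finite index (Lagrange on `Δ ⊔ H`, this seat's
`T5FiniteOrderExtension.pow_eq_one_of_finiteIndex`). -/
theorem pow_eq_one_of_sup_finiteIndex (Δ H : Subgroup G) [(Δ ⊔ H).FiniteIndex]
    (ψ' : G →* Q) (ψ : H →* Q) (h1 : ∀ h : H, ψ' h = ψ h) (h2 : ∀ d ∈ Δ, ψ' d = 1)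
    (n : ℕ) (hn : ∀ h : H, ψ h ^ n = 1) (g : G) : ψ' g ^ ((Δ ⊔ H).index * n) = 1 := by
  apply T5FiniteOrderExtension.pow_eq_one_of_finiteIndex (Δ ⊔ H) ψ' n
  intro x hx
  obtain ⟨d, hd, h, hh, rfl⟩ := Subgroup.mem_sup.mp hx
  have e : ψ' h = ψ ⟨h, hh⟩ := h1 ⟨h, hh⟩
  rw [map_mul, mul_pow, h2 d hd, one_pow, one_mul, e, hn]

/-- The image of `Δ ⊔ H` in `G ⧸ Δ` is an open subgroup: `(Δ ⊔ H).map (mk' Δ)` is open when `H` is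
(this seat's `T5SubgroupDescent.isOpen_image_sup_of_isOpen`). -/
theorem isOpen_map_sup (Δ H : Subgroup G) (hH : IsOpen (H : Set G)) :
    IsOpen (((Δ ⊔ H).map (QuotientGroup.mk' Δ) : Subgroup (G ⧸ Δ)) : Set (G ⧸ Δ)) := by
  have h := T5SubgroupDescent.isOpen_image_sup_of_isOpen H Δ hH
  rw [sup_comm] at h
  simpa [Subgroup.coe_map] using h

/-- **Compact quotient ⇒ finite index.** If `G ⧸ Δ` is compact and `H` is open, then `Δ ⊔ H` has
finite index in `G` (the open subgroup `(Δ ⊔ H)/Δ` of the compact group `G ⧸ Δ` has finite index,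
and `[G ⧸ Δ : (Δ ⊔ H)/Δ] = [G : Δ ⊔ H]` since `Δ ≤ Δ ⊔ H`). -/
theorem finiteIndex_sup_of_compactSpace_quotient (Δ H : Subgroup G) (hH : IsOpen (H : Set G))
    [CompactSpace (G ⧸ Δ)] : (Δ ⊔ H).FiniteIndex := by
  haveI : ((Δ ⊔ H).map (QuotientGroup.mk' Δ)).FiniteIndex :=
    T5FiniteOrderExtension.finiteIndex_of_isOpen _ (isOpen_map_sup Δ H hH)
  have hidx : ((Δ ⊔ H).map (QuotientGroup.mk' Δ)).index = (Δ ⊔ H).index :=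
    Subgroup.index_map_eq (Δ ⊔ H) (QuotientGroup.mk'_surjective Δ)
      (by rw [QuotientGroup.ker_mk']; exact le_sup_left)
  exact ⟨by rw [← hidx]; exact Subgroup.FiniteIndex.index_ne_zero⟩

variable [RootableBy Q ℤ]

/-- **§F.2's Pontryagin step, end to end.** `G ⧸ Δ` compact, `H` open, `ψ : H →* Q` continuous of
exponent `n`, trivial on `Δ ⊓ H`: there is a continuous character `Ψ` of `G ⧸ Δ` extending `ψ`
(`Ψ (h : G) = ψ h`), of exponent `[G : Δ ⊔ H] · n` — hence of finite order — and trivial on the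
image of every subgroup `U ≤ H` on which `ψ` is trivial. -/
theorem exists_continuous_quotient_character_pow_eq_one (Δ H : Subgroup G)
    (hH : IsOpen (H : Set G)) [CompactSpace (G ⧸ Δ)] (ψ : H →* Q) (hψ : Continuous ψ)
    (hΔ : ∀ x : H, (x : G) ∈ Δ → ψ x = 1) (n : ℕ) (hn : ∀ h : H, ψ h ^ n = 1) :
    ∃ Ψ : G ⧸ Δ →* Q, Continuous Ψ ∧ (∀ h : H, Ψ (h : G) = ψ h) ∧
      (∀ x : G ⧸ Δ, Ψ x ^ ((Δ ⊔ H).index * n) = 1) ∧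
      ∀ U : Subgroup G, U ≤ H → (∀ u : H, (u : G) ∈ U → ψ u = 1) →
        ∀ u ∈ U, Ψ (u : G) = 1 := by
  haveI := finiteIndex_sup_of_compactSpace_quotient Δ H hH
  obtain ⟨ψ', hc, h1, h2⟩ := exists_continuous_extension_eq_one_on Δ H hH ψ hψ hΔ
  have hker : Δ ≤ ψ'.ker := fun d hd => by
    rw [MonoidHom.mem_ker]
    exact h2 d hd
  have hcomp : (⇑(QuotientGroup.lift Δ ψ' hker) ∘ QuotientGroup.mk) = ⇑ψ' :=
    funext fun g => QuotientGroup.lift_mk Δ hker g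
  refine ⟨QuotientGroup.lift Δ ψ' hker, ?_, fun h => by rw [QuotientGroup.lift_mk, h1 h], ?_, ?_⟩
  · refine (QuotientGroup.isQuotientMap_mk Δ).continuous_iff.mpr ?_
    rw [hcomp]
    exact hc
  · intro x
    induction x using QuotientGroup.induction_on with
    | H g =>
      rw [QuotientGroup.lift_mk]
      exact pow_eq_one_of_sup_finiteIndex Δ H ψ' ψ h1 h2 n hn g
  · intro U hUH hU u hu
    rw [QuotientGroup.lift_mk]
    have e : ψ' u = ψ ⟨u, hUH hu⟩ := h1 ⟨u, hUH hu⟩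
    rw [e]
    exact hU ⟨u, hUH hu⟩ hu

/-- The character of the previous theorem has finite order in the group `G ⧸ Δ →* Q`
(when `n > 0`). -/
theorem exists_continuous_quotient_character_isOfFinOrder (Δ H : Subgroup G)
    (hH : IsOpen (H : Set G)) [CompactSpace (G ⧸ Δ)] (ψ : H →* Q) (hψ : Continuous ψ)
    (hΔ : ∀ x : H, (x : G) ∈ Δ → ψ x = 1) (n : ℕ) (hn0 : 0 < n) (hn : ∀ h : H, ψ h ^ n = 1) :
    ∃ Ψ : G ⧸ Δ →* Q, Continuous Ψ ∧ (∀ h : H, Ψ (h : G) = ψ h) ∧ IsOfFinOrder Ψ := by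
  haveI := finiteIndex_sup_of_compactSpace_quotient Δ H hH
  obtain ⟨Ψ, hc, h1, hpow, -⟩ :=
    exists_continuous_quotient_character_pow_eq_one Δ H hH ψ hψ hΔ n hn
  refine ⟨Ψ, hc, h1, ?_⟩
  rw [isOfFinOrder_iff_pow_eq_one]
  refine ⟨(Δ ⊔ H).index * n,
    Nat.mul_pos (Nat.pos_of_ne_zero Subgroup.FiniteIndex.index_ne_zero) hn0, ?_⟩
  refine MonoidHom.ext fun x => ?_
  rw [MonoidHom.pow_apply, MonoidHom.one_apply]
  exact hpow x

end finiteOrder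

section units

/-- The ℂˣ-valued form (the target `Q = ℂˣ` is ℤ-rootable by p4's instance): the character
`ψ_T ⊗ 1` of `H_𝔪`, trivial on `Γ_𝔪 = E¹ ∩ H_𝔪`, of exponent `n`, extends to a continuous
character of `E¹(𝔸)/E¹` of exponent `[E¹(𝔸) : E¹H_𝔪] · n`. -/
theorem exists_continuous_quotient_character_units (Δ H : Subgroup G)
    (hH : IsOpen (H : Set G)) [CompactSpace (G ⧸ Δ)] (ψ : H →* ℂˣ) (hψ : Continuous ψ)
    (hΔ : ∀ x : H, (x : G) ∈ Δ → ψ x = 1) (n : ℕ) (hn : ∀ h : H, ψ h ^ n = 1) :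
    ∃ Ψ : G ⧸ Δ →* ℂˣ, Continuous Ψ ∧ (∀ h : H, Ψ (h : G) = ψ h) ∧
      ∀ x : G ⧸ Δ, Ψ x ^ ((Δ ⊔ H).index * n) = 1 := by
  obtain ⟨Ψ, hc, h1, hpow, -⟩ :=
    exists_continuous_quotient_character_pow_eq_one Δ H hH ψ hψ hΔ n hn
  exact ⟨Ψ, hc, h1, hpow⟩

end units

end Summit.Ventures.HodgeRepro2.T5PontryaginStep
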